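import Summits.QuantumFields.BalabanUV.T4Continuum.Support.NE3EnergyHessTwoTerm
import Summits.QuantumFields.BalabanUV.T4Continuum.Support.MinimalActionWitness
import Literature.MathematicalPhysics.QuantumFieldTheory.Balaban1983to89.MatrixNorms

/-!
# T⁴ programme, node NE3 — row E-ML_w, sub-leaf (w1) FLAT CORE: at the flat background the Wilson Hessian is the
# normalised Hilbert–Schmidt square of the dressed curl, hence dominates `(1∕N)·curlSq`

NE3 (node U1b) formalisation swarm, leaf seat `b2b-balaban-t4-ne3-formalise-leaf-03` (gen 5), row **E-ML_w (w1)** of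
the owner's skeleton v1.9 §4b (`t4/skeletons/NE3-t4-ne3-p1.md`: «(w1) FLAT CORE `hess 1 Y Y ≥ (1/n)·curlSq 1 Y F` (at
`W = 1` the Hessian density is `‖curl‖²_{HS}/n`: `dcurlAt 1 Y Y` is a sum of commutators, traceless) … crew (w1)(w2)(w3)
claimable NOW (generic, flat)»; journal INTENT ∕ CLAIM l.13057).  The first of the three elementary flat-background inputs
of the weighted tangent coercivity (ML_w) = `NE3EnergyWeightedShapes.WeightedTangentCoercive` — the others being (w2) the
lattice Weitzenböck identity and (w3) the block-Poincaré inequality on `ker d(avgIter k)(1)`.  WHAT IS PROVED ([folklore];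
0 `def`, 0 `sorry`; `N := Fintype.card n`) — (w1) IS ALREADY IN THE TREE BY NAME as the radius-`0` case of road P3's
small-field lower bound `NE3HessBounds.hess_self_ge` (`(Σ_W‖curl‖²)∕N − 7a·Σ_W bondSq ≤ hess V X X W`) together with the
(3.10) split `NE3HessBounds.hessPlaqAt_self_eq`; this thin file records the LITERAL §4b form for the typer's row:
* §1 `isUnitaryCfg_flatCfg`, `smallField_flatCfg_zero` (plaquette radius `0`);
* §2 `hessPlaq_flatCfg_eq_nhsNormSq` — for skew `Y`: `hessPlaq flatCfg Y Y p = nhsNormSq (curl flatCfg Y p)` (the owner's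
  «‖curl‖²_{HS}∕n», EXACT, for every skew direction — central or not); `hessPlaq_flatCfg_nonneg`, `hess_flatCfg_nonneg`,
  `hess_flatCfg_eq_sum_nhsNormSq`;
* §3 **`hess_flatCfg_ge_sum`** (`(N:ℝ)⁻¹·Σ_{p∈W}‖curl flatCfg Y p‖² ≤ hess flatCfg Y Y W`, any window) and
  **`hess_flatCfg_ge_curlSq`** (`(N:ℝ)⁻¹·curlSq flatCfg Y F ≤ hess flatCfg Y Y (F ×ˢ univ)` = §4b (w1) LITERALLY).
CURRENCY NOTE for (w2)∕(w3) (honest): the flat Hessian is EXACTLY the Hilbert–Schmidt-normalised curl square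
(`Σ nhsNormSq`); the tree's `curlSq` uses the OPERATOR norm, related by `nhsNormSq ≤ ‖·‖² ≤ N·nhsNormSq`
(`MatrixNorms`), so a lattice Weitzenböck IDENTITY lives in the `nhsNormSq` currency and passes to `curlSq`∕`dirSq` only as
inequalities with factors of `N`.
CONSISTENCY: for CENTRAL directions (`Y = s·(i·1)`) both norms agree and §2 is the owner's `NE3TangentNoGoForms.hessPlaq_flat_Xw`
∕ NE3-R2's `NE3CoercivityScalingPrep.hess_flatCfg_iWave` equality `hess 1 X X = curlSq 1 X`.

HONEST FRAMING.  Finite-T⁴ bookkeeping (rung (B)+1); a matrix identity at ONE (flat) configuration; it is NOT (ML_w) — the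
weighted coercivity needs (w2)(w3) (flat) and (w4) (small background) on top; nothing about Bałaban's minimisers; T-E_w ∕
NE3 NOT proved; spine PROVED 0∕9; no conditional of the cell used or hidden; NOT infinite volume, NOT a mass gap, NOT Clay,
NOT summit progress.  ABSOLUTE RULE kept: no printed sentence is a hypothesis (context only: [Balaban1985Averaging] (17),
(20) p. 20–21 — the trace norms; [Balaban1985BackgroundPropagators] (3.10) p. 392 — `⟨A, ΔA⟩ = ⟨A, D*DA⟩ + ⟨A, Δ′A⟩`, whose
`Δ′` vanishes at the flat background).  PLACEMENT: `Summits/QuantumFields/BalabanUV/`; imports this lineage's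
`Support.NE3EnergyHessTwoTerm` (gen 4; for road P3's `NE3HessBounds` in its cone), `Support.MinimalActionWitness` (`flatCfg`)
and the Literature module `MatrixNorms` BY NAME; restates nothing (the gate's dedup lint pointed to
`NE3HessBounds.neg_nReTr_mul_self_of_skew` — reused, not restated), moves nothing.  HONEST DEPENDENCY: continuum YM on T⁴ ⇐ BetaPertH ∧ nine spine estimates (0/9
proved); BetaPertH ⇐ (D1) ∧ (D4) ∧ CAP+tail; G-an2-4 gates asym, D1 and NE2/3/4.
-/

set_option autoImplicit false

open scoped BigOperators Matrix Matrix.Norms.L2Operator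
open NormedSpace Finset

namespace Summit.QuantumFields.BalabanUV.T4Continuum.NE3FlatHessianCurl

open Literature.MathematicalPhysics.QuantumFieldTheory.Balaban1983to89
open B7Prop1Explicit B7Prop2Explicit MatrixLog UnitaryModel
open T4AveragingDeficitWall hiding Site Plane Plaq Bond
open MatrixNorms (nhsNormSq nhsNormSq_nonneg)
open MinimalActionWitness (flatCfg)
open NE3HessForm (dcurlAt hessPlaqAt hessPlaq hess)
open NE3HessShapes (curlSq_eq_sum_plaqsOf)
open NE3HessBounds (hessPlaqAt_self_eq hess_self_ge)

noncomputable section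

variable {d : ℕ} {n : Type*} [Fintype n] [DecidableEq n]

/-! ## §1 The flat configuration: unitary, plaquette radius `0` -/

/-- The flat configuration is the constant configuration `1`. [folklore] -/
theorem flatCfg_eq_one : (flatCfg : Site d → Fin d → (Matrix n n ℂ)ˣ) = fun _ _ => 1 := rfl

/-- The flat configuration is `U(N)`-valued. [folklore] -/
theorem isUnitaryCfg_flatCfg : IsUnitaryCfg (flatCfg : Site d → Fin d → (Matrix n n ℂ)ˣ) :=
  fun _ _ => (unitaryUnits (Matrix n n ℂ)).one_mem

/-- The flat configuration has plaquette radius `0`. [folklore] -/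
theorem smallField_flatCfg_zero : SmallField (flatCfg : Site d → Fin d → (Matrix n n ℂ)ˣ) 0 := by
  intro z μ ν _
  rw [flatCfg_eq_one, hol_flat]
  simp

/-! ## §2 The Hessian density at the flat configuration (road P3's (3.10) split `NE3HessBounds.hessPlaqAt_self_eq` BY NAME) -/

/-- **THE FLAT HESSIAN DENSITY OF A SKEW DIRECTION IS THE NORMALISED HILBERT–SCHMIDT SQUARE OF ITS DRESSED CURL**:
`hessPlaq flatCfg Y Y p = nhsNormSq (curl flatCfg Y p)` — road P3's identity `NE3HessBounds.hessPlaqAt_self_eq`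
(`hessPlaqAt V X X = nhsNormSq (d_V X) − Re tr[(…)·(V(∂p′) − 1)]`) at `V(∂p′) = 1` (`hol_flat`).  The owner's «‖curl‖²_{HS}∕n»
for EVERY skew direction (central or not). [folklore] -/
theorem hessPlaq_flatCfg_eq_nhsNormSq {Y : Site d → Fin d → Matrix n n ℂ} (hY : IsSkewDir Y)
    (p : T4AveragingDeficitWall.Plaq d) : hessPlaq flatCfg Y Y p = nhsNormSq (curl flatCfg Y p) := by
  have hhol : ((hol (flatCfg : Site d → Fin d → (Matrix n n ℂ)ˣ) p.1 (plaqWord p.2.1.1 p.2.1.2) : (Matrix n n ℂ)ˣ)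
      : Matrix n n ℂ) = 1 := by
    rw [flatCfg_eq_one, hol_flat]; rfl
  unfold NE3HessForm.hessPlaq
  rw [hessPlaqAt_self_eq isUnitaryCfg_flatCfg hY, hhol, sub_self, mul_zero]
  show nhsNormSq (curlAt flatCfg Y p.1 p.2.1.1 p.2.1.2) - nReTr 0 = nhsNormSq (curl flatCfg Y p)
  simp [UnitaryModel.nReTr, curl]

/-- The flat Hessian density of a skew direction is non-negative. [folklore] -/
theorem hessPlaq_flatCfg_nonneg {Y : Site d → Fin d → Matrix n n ℂ} (hY : IsSkewDir Y)
    (p : T4AveragingDeficitWall.Plaq d) : 0 ≤ hessPlaq flatCfg Y Y p := by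
  rw [hessPlaq_flatCfg_eq_nhsNormSq hY]; exact nhsNormSq_nonneg _

/-- The flat Hessian of a skew direction is non-negative on every window. [folklore] -/
theorem hess_flatCfg_nonneg {Y : Site d → Fin d → Matrix n n ℂ} (hY : IsSkewDir Y)
    (W : Finset (T4AveragingDeficitWall.Plaq d)) : 0 ≤ hess flatCfg Y Y W := by
  unfold NE3HessForm.hess
  exact Finset.sum_nonneg fun p _ => hessPlaq_flatCfg_nonneg hY p

/-! ## §3 (w1): the flat Hessian dominates `(1∕N)·curlSq` (road P3's `NE3HessBounds.hess_self_ge` at radius `0` BY NAME) -/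

/-- **(w1) ON A WINDOW**: for a skew direction `Y` and every plaquette window `W`,
`(N:ℝ)⁻¹·Σ_{p∈W}‖curl flatCfg Y p‖² ≤ hess flatCfg Y Y W` — road P3's small-field lower bound
`NE3HessBounds.hess_self_ge` (`(Σ‖curl‖²)∕N − 7a·Σ bondSq ≤ hess`) at the flat configuration, radius `a = 0`. [folklore] -/
theorem hess_flatCfg_ge_sum [Nonempty n] {Y : Site d → Fin d → Matrix n n ℂ} (hY : IsSkewDir Y)
    (W : Finset (T4AveragingDeficitWall.Plaq d)) :
    (Fintype.card n : ℝ)⁻¹ * ∑ p ∈ W, ‖curl flatCfg Y p‖ ^ 2 ≤ hess flatCfg Y Y W := by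
  have h := hess_self_ge isUnitaryCfg_flatCfg hY smallField_flatCfg_zero W
  rw [mul_zero, zero_mul, sub_zero] at h
  rw [inv_mul_eq_div]
  exact h

/-- **(w1) OF SKELETON v1.9 §4b, LITERALLY**: for a skew direction `Y` and every site set `F`,
`(N:ℝ)⁻¹·curlSq flatCfg Y F ≤ hess flatCfg Y Y (F ×ˢ univ)` — at the flat background the Wilson Hessian dominates `(1∕N)`
times the curl part of the (weighted or unweighted) energy norm (`NE3HessShapes.curlSq_eq_sum_plaqsOf`). [folklore] -/
theorem hess_flatCfg_ge_curlSq [Nonempty n] {Y : Site d → Fin d → Matrix n n ℂ} (hY : IsSkewDir Y) (F : Finset (Site d)) :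
    (Fintype.card n : ℝ)⁻¹ * curlSq flatCfg Y F ≤ hess flatCfg Y Y (F ×ˢ Finset.univ) := by
  rw [curlSq_eq_sum_plaqsOf]
  exact hess_flatCfg_ge_sum hY _

/-- The same with the exact value: `hess flatCfg Y Y W = Σ_{p∈W} nhsNormSq (curl flatCfg Y p)`. [folklore] -/
theorem hess_flatCfg_eq_sum_nhsNormSq {Y : Site d → Fin d → Matrix n n ℂ} (hY : IsSkewDir Y)
    (W : Finset (T4AveragingDeficitWall.Plaq d)) :
    hess flatCfg Y Y W = ∑ p ∈ W, nhsNormSq (curl flatCfg Y p) := by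
  unfold NE3HessForm.hess
  exact Finset.sum_congr rfl fun p _ => hessPlaq_flatCfg_eq_nhsNormSq hY p

end

end Summit.QuantumFields.BalabanUV.T4Continuum.NE3FlatHessianCurl
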